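import Summits.QuantumFields.BalabanUV.Beta.FP.TowerDoorRecordPairingGS
import Summits.QuantumFields.BalabanUV.Beta.FP.TowerDoorUniformDataSym
import Summits.QuantumFields.BalabanUV.Beta.FP.QstepSymTwoBlock
import Summits.QuantumFields.BalabanUV.Beta.FP.QstepCtrTwoBlock

/-!
# `BalabanUV.Beta.FP.TowerDoorRecordThetaGS` — binder row D1 ∕ (C1), THE L DOOR's LETTER `hΘ` (U), over `(Q, tabs)` under road (B)'s two-block letter `hQ`:
# **`Σ'_y τd j κ y (lamd j μ 0) = 0` AT THE L-CHART `ANs ρ_c Ψ̂ˢ`** — PART 88 `TowerDoorRecordLettersG.hΘ_recG` with the ONE chart token changed, its two chart facts supplied by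
# gen-94 `TowerDoorUniformDataSym` (the (0.4) face read-out) through the chart-GENERIC PART 84 `TowerDoorGaugeLatticeSumG.hasSum_lamZG_sources` and PART 86
# `TowerDoorGaugeFunctionalG.tsum_tsum_translate_mul_lamZG_eq_zero ∕ memℓp_top_lamZG`
# (β-function cell `pub-balaban`, BINDER-OWNERS row D1 ∕ (C1) OWNER «beta-an2» gen 94, L-door wave 2; completes the L door's letter set `hτd hτda hΘ hWΔ₂ hX` with gen-94 `TowerDoorRecordLettersGS`).

WHY (located).  PART 84 asks of the chart `A` (hAs) summable sublattice field–multiplier columns and (hface) the face read-out; PART 52∕58 supply them at the rooted record chart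
`scaleK σ σ (AN R (n+1))` (`TowerDoorUniformDataTorus.summable_scaleK_AN_inl_inr_sources`, `TowerDoorGaugeLatticeSum.tsum_scaleK_AN_sources_eq_zero_of_quo_eq`).  §1 is their twin at
`scaleK σ σ (ANs R (ΨL R) (n+1))`: summability from S-L1 `decays_ANs` (fed S-L3b `hΨsL`) and lit `summable_translate_of_decays`; the read-out from gen-94 `tsum_ANs_inl_inr_sources_eq` and PART 53
`faceField_faceSupported`.  §2 feeds PART 84∕86's generic theorems; §3 is PART 88 §1's `hΘ_recG` proof verbatim over the GS pairing data (`TowerDoorRecordPairingGS.lamdRecGS ∕ tauRecGS`).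

WHAT ([folklore] BY NAME; no `def`, no `def … : Prop`, nothing cited, 0 sorry):
§1 `ΨL_eq` (`rfl`), `decays_scaleK_ANs_root` (any roots), **`summable_scaleK_ANs_inl_inr_sources`**, **`tsum_scaleK_ANs_inl_inr_sources_eq`**, **`tsum_scaleK_ANs_sources_eq_zero_of_quo_eq`**;
§2 **`hasSum_lamZG_sources_recordS`**, `tsum_lamZG_sources_recordS` (LEMMA U on the lattice at the L-chart: `Σ'_z λℤ_(μ,z)(u) = 0`, under `hQ`), **`tsum_tsum_translate_mul_lamZG_recordS_eq_zero`**,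
`memℓp_top_lamZG_recordS`, **`tsum_l1Pairing_lamZG_recordS_eq_zero`** (the END's `hΘ` AS TYPED at the L-chart); §3 **`hΘ_recGS`**:
`∀ j κ μ, Σ'_y tauRecGS Lc tabs κ₂ κτ j κ y (lamdRecGS Lc Q sn j μ 0) = 0` under `hQ` — S-END's `hΘ` for the L door `(lamdRecGS, tauRecGS)`.
WHAT THIS IS NOT: not `hlawL`, not S-L3b's crux `d1Tel_L_of_hlawL'`, not `hG`∕`hWΔT`∕any of v10's 118 displayed rows at the L door; road (B)'s (TB) letter `hQ` stays displayed exactly as in PART 84∕86∕88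
(discharged at `QSym Lc` by road `QSym_twoBlock` and at the centred rooted family by an2 PART 80 `QCtr_twoBlock` — instances not restated here); nothing of Bałaban's asserted, valued or
discharged; 0 estimates; 0∕4 row-D1 binders (hW, hR, D1Tel, D1Rep); NOT (C1), NOT (T-ID), NOT D1, NEVER «G-an2-4 closed», NOT BetaPertH, NOT continuum, NOT Clay.

HONEST DEPENDENCY (page 1, mandatory): continuum YM on T⁴ ⇐ BetaPertH ∧ nine spine estimates (0/9 proved); BetaPertH ⇐ (D1) ∧ (D4) ∧ CAP+tail;
G-an2-4 gates asym, D1 and NE2/3/4.  HONEST FRAMING (cell contract, verbatim): «discharging `BetaPertH` makes Bałaban's UV stability UNCONDITIONAL —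
a real constructive-QFT result; it is NOT the continuum limit and NOT the Clay problem.»  ABSOLUTE RULE (cell charter, verbatim): «No internally-minted
statement may enter as a cited fact. Every hypothesis is either kernel-proved in this package or a verbatim quotation of a PUBLISHED theorem with page
reference. The manuscript(s) under audit are NOT citable for their own disputed steps — they are the thing under adjudication; programme-internal
(2001/route/tribunal) claims are never citable.»  Row D1 ∕ (C1) OWNER «beta-an2» gen 94, 2026-08-31.  No existing file touched.
-/

noncomputable section

open Finset
open scoped BigOperators
open Literature.MathematicalPhysics.QuantumFieldTheory
open Literature.MathematicalPhysics.QuantumFieldTheory.Balaban1983to89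
open Literature.MathematicalPhysics.QuantumFieldTheory.Balaban1983to89.Beta
open Literature.MathematicalPhysics.QuantumFieldTheory.LatticeForm (quo)
open B4TorusKernel.MultiPeriod (translate)
open B5Prop11Plancherel (fine)
open B6Lemma24Torus (pbox)
open AffineAveraging (Site unitVec toSite)
open AveragingContoursRooted (ctrOff ctrOff_mem_box)
open OneStepResolventKernel (Fib)
open ExpKernelCalculus (MKer Decays)
open HessKerRate (scaleK scaleK_apply decays_scaleK)
open Summit.QuantumFields.BalabanUV.Beta.SymmetrisedStepJets (SymTables)
open Summit.QuantumFields.BalabanUV.Beta.CompositeOneShotJetData (Roots)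
open Summit.QuantumFields.BalabanUV.Beta.CompositeCorrectorKernelSym (psiKSym)
open Summit.QuantumFields.BalabanUV.Beta.FP.CompositeOneShotJetDataSym (ANs decays_ANs)
open Summit.QuantumFields.BalabanUV.Beta.FP.StepRecursionSymEnd (ΨL hΨsL)
open Summit.QuantumFields.BalabanUV.Beta.FP.KernelPeriodisationFib (summable_translate_of_decays)
open Summit.QuantumFields.BalabanUV.Beta.GAN24.FineReadoutCauchyFrame (toSite_mem_range)
open Summit.QuantumFields.BalabanUV.Beta.FP.TorusCompositeObjects (bigRatio bigRatio_eq_pow)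
open Summit.QuantumFields.BalabanUV.Beta.FP.TorusCompositeObjectsG (StepRows)
open Summit.QuantumFields.BalabanUV.Beta.FP.TowerDoorGaugeRefDefsG (lamZG)
open Summit.QuantumFields.BalabanUV.Beta.FP.TowerDoorGaugeLatticeSumG (hasSum_lamZG_sources)
open Summit.QuantumFields.BalabanUV.Beta.FP.TowerDoorGaugeFunctional (l1Pairing l1Pairing_apply)
open Summit.QuantumFields.BalabanUV.Beta.FP.TowerDoorGaugeFunctionalG (memℓp_top_lamZG tsum_tsum_translate_mul_lamZG_eq_zero)
open Summit.QuantumFields.BalabanUV.Beta.FP.TowerDoorUniformDataNested (faceField_faceSupported)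
open Summit.QuantumFields.BalabanUV.Beta.FP.TowerDoorUniformDataSym (tsum_ANs_inl_inr_sources_eq)
open Summit.QuantumFields.BalabanUV.Beta.FP.TowerDoorRecordDefsGS (lamRecGS omegaRecGS)
open Summit.QuantumFields.BalabanUV.Beta.FP.TowerDoorRecordPairingGS (lamdRecGS tauRecGS summable_abs_omegaRecGS)

namespace Summit.QuantumFields.BalabanUV.Beta.FP.TowerDoorRecordThetaGS

/-! ## §1 The `σ`-conjugated L-chart: summable sublattice columns and the face read-out -/

section Chart

variable {Lc : ℕ} [NeZero Lc] (R : Roots Lc) (j : ℕ)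

omit [NeZero Lc] in
/-- [folklore] S-L3b's corrector family unfolded (`rfl`): `ΨL R = (m ↦ Ψ̂ˢ_m)`. -/
theorem ΨL_eq : ΨL R = fun m => psiKSym R.rc Lc m := rfl

/-- [folklore] the `σ`-conjugated L-chart decays, any roots (S-L1 `decays_ANs` fed S-L3b `hΨsL`, lit `decays_scaleK`, `|σ a| ≤ Σ |σ a′|`) — gen-94 `TowerDoorRecordPairingGS.decays_scaleK_ANs` is the
centred instance. -/
theorem decays_scaleK_ANs_root (σ : Fib 3 → ℝ) :
    ∃ δ C : ℝ, 0 < δ ∧ 0 ≤ C ∧ Decays (scaleK σ σ (ANs R (ΨL R) j)) C δ := by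
  obtain ⟨δ, C, hδ, hC, hA⟩ := decays_ANs R (ΨL R) (hΨsL R) j
  have hσ : ∀ a : Fib 3, |σ a| ≤ ∑ a', |σ a'| := fun a => Finset.single_le_sum (fun a' _ => abs_nonneg (σ a')) (Finset.mem_univ a)
  exact ⟨δ, (∑ a', |σ a'|) * C * ∑ a', |σ a'|, hδ,
    mul_nonneg (mul_nonneg (Finset.sum_nonneg fun _ _ => abs_nonneg _) hC) (Finset.sum_nonneg fun _ _ => abs_nonneg _), decays_scaleK hσ hσ hA⟩

/-- [folklore] **`summable_scaleK_ANs_inl_inr_sources`** — the sublattice field–multiplier columns of the `σ`-conjugated L-chart are summable (S-L1 `decays_ANs`, lit `summable_translate_of_decays`,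
constants out) — PART 52 `summable_scaleK_AN_inl_inr_sources` at `ANs`. -/
theorem summable_scaleK_ANs_inl_inr_sources (u v : Fib 3 → ℝ) (x : Site (3 + 1)) (κ μ : Fin (3 + 1)) :
    Summable (fun z : Site (3 + 1) => scaleK u v (ANs R (ΨL R) j) x (((Lc ^ (j + 1) : ℕ) : ℤ) • z) (Sum.inl κ) (Sum.inr μ)) := by
  obtain ⟨δ, C, hδ, hC, hA⟩ := decays_ANs R (ΨL R) (hΨsL R) j
  have h := summable_translate_of_decays hA hC hδ (Q := fun _ : Fin (3 + 1) => Lc ^ (j + 1))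
    (fun _ => Nat.one_le_iff_ne_zero.mpr (NeZero.ne (Lc ^ (j + 1)))) x 0 (Sum.inl κ) (Sum.inr μ)
  have e : (fun m : Site (3 + 1) => ANs R (ΨL R) j x (translate (fun _ : Fin (3 + 1) => Lc ^ (j + 1)) 0 m) (Sum.inl κ) (Sum.inr μ))
      = fun z : Site (3 + 1) => ANs R (ΨL R) j x (((Lc ^ (j + 1) : ℕ) : ℤ) • z) (Sum.inl κ) (Sum.inr μ) := by
    funext m; congr 1; funext i
    simp only [B4TorusKernel.MultiPeriod.translate_apply, Pi.zero_apply, zero_add, Pi.smul_apply, smul_eq_mul]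
  rw [e] at h
  simp only [scaleK_apply]
  exact (h.mul_left (u (Sum.inl κ))).mul_right (v (Sum.inr μ))

/-- [folklore] **`tsum_scaleK_ANs_inl_inr_sources_eq` — THE `σ`-CONJUGATED L-CHART's RESPONSE TO UNIFORM DATA**: with `σ` acting by constants per leg type,
`Σ'_z (σ·ANs·σ) x (L•z) (inl κ) (inr μ) = u⁽ᶠ⁾ κ · v⁽ᵐ⁾ μ · (if x_κ % L = L − 1 then L·δ_{κμ}·L^{−(d+2)} else 0)` (gen-94 `tsum_ANs_inl_inr_sources_eq`, constants out). -/
theorem tsum_scaleK_ANs_inl_inr_sources_eq (u v : Fib 3 → ℝ) (x : Site (3 + 1)) (κ μ : Fin (3 + 1)) :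
    (∑' z : Site (3 + 1), scaleK u v (ANs R (ΨL R) j) x (((Lc ^ (j + 1) : ℕ) : ℤ) • z) (Sum.inl κ) (Sum.inr μ))
      = u (Sum.inl κ) * v (Sum.inr μ) *
        (if x κ % ((Lc ^ (j + 1) : ℕ) : ℤ) = ((Lc ^ (j + 1) : ℕ) : ℤ) - 1
          then ((Lc ^ (j + 1) : ℕ) : ℝ) * (if κ = μ then ((((Lc ^ (j + 1) : ℕ) : ℝ) ^ (3 + 1 + 1))⁻¹) else 0) else 0) := by
  simp only [scaleK_apply, ΨL_eq]
  have e : (fun z : Site (3 + 1) => u (Sum.inl κ) * ANs R (fun m => psiKSym R.rc Lc m) j x (((Lc ^ (j + 1) : ℕ) : ℤ) • z) (Sum.inl κ) (Sum.inr μ) * v (Sum.inr μ))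
      = fun z => (u (Sum.inl κ) * v (Sum.inr μ)) * ANs R (fun m => psiKSym R.rc Lc m) j x (((Lc ^ (j + 1) : ℕ) : ℤ) • z) (Sum.inl κ) (Sum.inr μ) := by
    funext z; ring
  rw [e, tsum_mul_left, tsum_ANs_inl_inr_sources_eq R j x κ μ]

/-- [folklore] **`tsum_scaleK_ANs_sources_eq_zero_of_quo_eq`** — the face read-out of the `σ`-conjugated L-chart vanishes on a bond whose endpoints share their `L`-block (§1 + PART 53
`faceField_faceSupported`) — PART 58 `tsum_scaleK_AN_sources_eq_zero_of_quo_eq` at `ANs`. -/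
theorem tsum_scaleK_ANs_sources_eq_zero_of_quo_eq (σ : Fib 3 → ℝ) (n : ℕ) (x : Site (3 + 1)) (κ μ : Fin (3 + 1))
    (h : quo (bigRatio Lc (n + 1)) x = quo (bigRatio Lc (n + 1)) (x + unitVec κ)) :
    (∑' z : Site (3 + 1), scaleK σ σ (ANs R (ΨL R) (n + 1)) x (((bigRatio Lc (n + 1) : ℕ) : ℤ) • z) (Sum.inl κ) (Sum.inr μ)) = 0 := by
  rw [bigRatio_eq_pow] at h ⊢
  rw [tsum_scaleK_ANs_inl_inr_sources_eq R (n + 1) σ σ x κ μ,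
    faceField_faceSupported (Nat.one_le_iff_ne_zero.mpr (NeZero.ne (Lc ^ (n + 1 + 1))))
      (fun κ' _ => ((Lc ^ (n + 1 + 1) : ℕ) : ℝ) * (if κ' = μ then ((((Lc ^ (n + 1 + 1) : ℕ) : ℝ) ^ (3 + 1 + 1))⁻¹) else 0)) κ x h, mul_zero]

end Chart

/-! ## §2 LEMMA U on the lattice and `hΘ`'s shape at the L-chart, over `Q` under (TB) `hQ` (PART 84∕86's generic theorems fed §1) -/

section Record

variable {Lc : ℕ} [NeZero Lc] (Q : StepRows 3 Lc)
  (hQ : ∀ (M : Fin (3 + 1) → ℕ) [∀ μ, NeZero (M μ)] (ℓ : ℕ) (r : Fin (3 + 1) → ℕ) (a : ↥(pbox M)) (ν : Fin (3 + 1))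
      (b : ↥(pbox (fine Lc M))) (κ : Fin (3 + 1)),
      (a : Site (3 + 1)) + unitVec ν ∈ pbox M → Q M ℓ r (a, ν) (b, κ) ≠ 0 →
        (quo Lc (b : Site (3 + 1)) = a ∨ quo Lc (b : Site (3 + 1)) = (a : Site (3 + 1)) + unitVec ν) ∧
        (quo Lc ((b : Site (3 + 1)) + unitVec κ) = a ∨ quo Lc ((b : Site (3 + 1)) + unitVec κ) = (a : Site (3 + 1)) + unitVec ν))
  (R : Roots Lc) (lev : ℕ → ℕ) (rs : ℕ → (Fin (3 + 1) → ℕ))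
  (hrs : ∀ k i, 0 ≤ toSite (rs k) i ∧ toSite (rs k) i < (Lc : ℤ)) (n : ℕ) (σ : Fib 3 → ℝ)

include hQ in
/-- [folklore] **`hasSum_lamZG_sources_recordS` — LEMMA U ON THE LATTICE FOR THE L-CHART**: `HasSum (z ↦ lamZG Lc Q lev rs hrs n (scaleK σ σ (ANs R (ΨL R) (n+1))) μ z u) 0` for every lattice site
`u`, every root list, under (TB) `hQ` (PART 84 `hasSum_lamZG_sources` fed §1). -/
theorem hasSum_lamZG_sources_recordS (μ : Fin (3 + 1)) (u : Site (3 + 1)) :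
    HasSum (fun z : Site (3 + 1) => lamZG Lc Q lev rs hrs n (scaleK σ σ (ANs R (ΨL R) (n + 1))) μ z u) 0 :=
  hasSum_lamZG_sources Lc Q hQ lev rs hrs n (scaleK σ σ (ANs R (ΨL R) (n + 1))) μ
    (fun x κ => by rw [bigRatio_eq_pow]; exact summable_scaleK_ANs_inl_inr_sources R (n + 1) σ σ x κ μ)
    (fun x κ h => tsum_scaleK_ANs_sources_eq_zero_of_quo_eq R σ n x κ μ h) u

include hQ in
/-- [folklore] **`tsum_lamZG_sources_recordS`**: `Σ'_z lamZG Lc Q lev rs hrs n (scaleK σ σ (ANs R (ΨL R) (n+1))) μ z u = 0` — K2L-LAM's «Λ_μ constant» ON THE LATTICE at the L-chart, the constant being `0`. -/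
theorem tsum_lamZG_sources_recordS (μ : Fin (3 + 1)) (u : Site (3 + 1)) :
    (∑' z : Site (3 + 1), lamZG Lc Q lev rs hrs n (scaleK σ σ (ANs R (ΨL R) (n + 1))) μ z u) = 0 :=
  (hasSum_lamZG_sources_recordS Q hQ R lev rs hrs n σ μ u).tsum_eq

include hQ in
/-- [folklore] **`tsum_tsum_translate_mul_lamZG_recordS_eq_zero`** — `hΘ`'s shape for the L-chart, hypothesis-free but for `Σ|ω| < ∞` and (TB):
`Σ'_y Σ'_u ω(u − L•y)·lamZG Lc Q lev rs hrs n (scaleK σ σ (ANs R (ΨL R) (n+1))) μ 0 u = 0` (PART 86 `tsum_tsum_translate_mul_lamZG_eq_zero`). -/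
theorem tsum_tsum_translate_mul_lamZG_recordS_eq_zero (ω : Site (3 + 1) → ℝ) (hω : Summable (fun u => |ω u|)) (μ : Fin (3 + 1)) :
    (∑' y : Site (3 + 1), ∑' u : Site (3 + 1),
        ω (u - ((bigRatio Lc (n + 1) : ℕ) : ℤ) • y) * lamZG Lc Q lev rs hrs n (scaleK σ σ (ANs R (ΨL R) (n + 1))) μ 0 u) = 0 := by
  obtain ⟨δ, C, hδ, _, hA⟩ := decays_scaleK_ANs_root R (n + 1) σ
  exact tsum_tsum_translate_mul_lamZG_eq_zero Lc Q lev rs hrs n (scaleK σ σ (ANs R (ΨL R) (n + 1))) hA hδ ω hω μ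
    (fun u => tsum_lamZG_sources_recordS Q hQ R lev rs hrs n σ μ u)

/-- [folklore] **`λℤ_(μ,z)` AT THE L-CHART IS A BOUNDED GAUGE FUNCTION** (`Memℓp … ⊤`; PART 86 `memℓp_top_lamZG` fed §1's decay). -/
theorem memℓp_top_lamZG_recordS (μ : Fin (3 + 1)) (z : Site (3 + 1)) :
    Memℓp (fun u : Site (3 + 1) => lamZG Lc Q lev rs hrs n (scaleK σ σ (ANs R (ΨL R) (n + 1))) μ z u) ⊤ := by
  obtain ⟨δ, C, hδ, _, hA⟩ := decays_scaleK_ANs_root R (n + 1) σ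
  exact memℓp_top_lamZG Lc Q lev rs hrs n hA hδ.le μ z

include hQ in
/-- [folklore] **`tsum_l1Pairing_lamZG_recordS_eq_zero` — THE END's `hΘ` AS TYPED, AT THE L-CHART, over `Q` (under (TB) `hQ`)**: with `V := ↥(lp (fun _ : Site 4 => ℝ) ⊤)`,
`τ κ y := κτ • l1Pairing (ω(· − L•y))`, `lam μ z := ⟨λℤ_(μ,z), memℓp⟩`: `Σ'_y τ κ y (lam μ 0) = 0`. -/
theorem tsum_l1Pairing_lamZG_recordS_eq_zero (ω : Site (3 + 1) → ℝ) (hω : Summable (fun u => |ω u|)) (κτ : ℝ) (μ : Fin (3 + 1)) :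
    (∑' y : Site (3 + 1), (κτ • l1Pairing (fun u : Site (3 + 1) => ω (u - ((bigRatio Lc (n + 1) : ℕ) : ℤ) • y))
        ((Equiv.subRight (((bigRatio Lc (n + 1) : ℕ) : ℤ) • y)).summable_iff.mpr hω))
      (⟨fun u : Site (3 + 1) => lamZG Lc Q lev rs hrs n (scaleK σ σ (ANs R (ΨL R) (n + 1))) μ 0 u, memℓp_top_lamZG_recordS Q R lev rs hrs n σ μ 0⟩ :
        ↥(lp (fun _ : Site (3 + 1) => ℝ) ⊤))) = 0 := by
  simp only [LinearMap.smul_apply, l1Pairing_apply, smul_eq_mul]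
  rw [tsum_mul_left, tsum_tsum_translate_mul_lamZG_recordS_eq_zero Q hQ R lev rs hrs n σ ω hω μ, mul_zero]

end Record

/-! ## §3 The L door's letter `hΘ`, over `(Q, tabs)` under (TB) `hQ` -/

section Theta

variable (Lc : ℕ) [NeZero Lc] (Q : StepRows 3 Lc)
  (hQ : ∀ (M : Fin (3 + 1) → ℕ) [∀ μ, NeZero (M μ)] (ℓ : ℕ) (r : Fin (3 + 1) → ℕ) (a : ↥(pbox M)) (ν : Fin (3 + 1))
      (b : ↥(pbox (fine Lc M))) (κ : Fin (3 + 1)),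
      (a : Site (3 + 1)) + unitVec ν ∈ pbox M → Q M ℓ r (a, ν) (b, κ) ≠ 0 →
        (quo Lc (b : Site (3 + 1)) = a ∨ quo Lc (b : Site (3 + 1)) = (a : Site (3 + 1)) + unitVec ν) ∧
        (quo Lc ((b : Site (3 + 1)) + unitVec κ) = a ∨ quo Lc ((b : Site (3 + 1)) + unitVec κ) = (a : Site (3 + 1)) + unitVec ν))
  (tabs : ∀ n : ℕ, SymTables 3 (Lc ^ (n + 1 + 1))) (sn κ₂ κτ : ℕ → ℝ)

include hQ in
/-- [folklore] **S-END `hΘ` FOR THE L DOOR, OVER `(Q, tabs)` — (U), under the two-block letter (TB) `hQ`**: `Σ'_y τd j κ y (lamd j μ 0) = 0` for the GS pairing data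
(`TowerDoorRecordPairingGS.lamdRecGS ∕ tauRecGS`; §2 `tsum_l1Pairing_lamZG_recordS_eq_zero` after one `bigRatio_eq_pow`; zero data at `j = 0`) — PART 88 `hΘ_recG` at the L-chart. -/
theorem hΘ_recGS : ∀ (j : ℕ) (κ μ : Fin (3 + 1)), ∑' y : Site (3 + 1), tauRecGS Lc tabs κ₂ κτ j κ y (lamdRecGS Lc Q sn j μ 0) = 0 := by
  intro j κ μ
  cases j with
  | zero => exact tsum_zero
  | succ n =>
    have h := tsum_l1Pairing_lamZG_recordS_eq_zero Q hQ (Roots.ctr Lc) (fun i : ℕ => n + 1 - i) (fun _ : ℕ => ctrOff (3 + 1) Lc)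
      (fun _ => toSite_mem_range (ctrOff_mem_box (d := 3 + 1) (Nat.one_le_iff_ne_zero.mpr (NeZero.ne Lc))))
      n (Sum.elim (fun _ : Fin (3 + 1) => (1 : ℝ)) (fun _ : Fin (3 + 1) => (sn n)⁻¹))
      (fun u => omegaRecGS Lc tabs (κ₂ n) n κ u) (summable_abs_omegaRecGS Lc tabs (κ₂ n) n κ) (κτ n) μ
    simp only [bigRatio_eq_pow] at h
    exact h

end Theta

/-! ## §4 The two instances of record: (TB) by name, NO displayed hypothesis (gen-94 append [AN2-G94-W-18]) -/

section Instances

open Summit.QuantumFields.BalabanUV.Beta.FP.TorusCompositeObjects (Qstep)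
open Summit.QuantumFields.BalabanUV.Beta.FP.TorusCompositeObjectsG (QSym)
open Summit.QuantumFields.BalabanUV.Beta.FP.QstepSymTwoBlock (QSym_twoBlock)
open Summit.QuantumFields.BalabanUV.Beta.FP.QstepCtrTwoBlock (QCtr_twoBlock)

variable (Lc : ℕ) [NeZero Lc] (tabs : ∀ n : ℕ, SymTables 3 (Lc ^ (n + 1 + 1))) (sn κ₂ κτ : ℕ → ℝ)

/-- [folklore] **v10's instance — `hΘ` AT THE L DOOR WITH NO DISPLAYED HYPOTHESIS**: at v10's (0.4) step-row family `QSym Lc` the two-block letter (TB) is road `QstepSymTwoBlock.QSym_twoBlock`,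
so §3 `hΘ_recGS` holds outright, for ANY table record `tabs` (in particular the graded record `CompositeOneShotJetsGraded.tabsRecG Lc Pn` of E-AN2-94-3's σ_T) — PART 88 `hΘ_rec_of_recG`'s twin. -/
theorem hΘ_recGS_QSym : ∀ (j : ℕ) (κ μ : Fin (3 + 1)), ∑' y : Site (3 + 1), tauRecGS Lc tabs κ₂ κτ j κ y (lamdRecGS Lc (QSym Lc) sn j μ 0) = 0 :=
  hΘ_recGS Lc (QSym Lc) (QSym_twoBlock Lc) tabs sn κ₂ κτ

/-- [folklore] **v11's instance** — at the CENTRED ROOTED step-row family `fun M _ ℓ _ => Qstep Lc M ℓ (ctrOff (3+1) Lc)` (TB) is an2 PART 80 `QstepCtrTwoBlock.QCtr_twoBlock` — PART 88 `hΘ_recG_ctr`'s twin. -/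
theorem hΘ_recGS_ctr : ∀ (j : ℕ) (κ μ : Fin (3 + 1)), ∑' y : Site (3 + 1), tauRecGS Lc tabs κ₂ κτ j κ y
    (lamdRecGS Lc (fun (M : Fin (3 + 1) → ℕ) (_ : ∀ μ, NeZero (M μ)) (ℓ : ℕ) (_ : Fin (3 + 1) → ℕ) => Qstep Lc M ℓ (ctrOff (3 + 1) Lc)) sn j μ 0) = 0 :=
  hΘ_recGS Lc (fun (M : Fin (3 + 1) → ℕ) (_ : ∀ μ, NeZero (M μ)) (ℓ : ℕ) (_ : Fin (3 + 1) → ℕ) => Qstep Lc M ℓ (ctrOff (3 + 1) Lc)) (QCtr_twoBlock Lc)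
    tabs sn κ₂ κτ

end Instances

end Summit.QuantumFields.BalabanUV.Beta.FP.TowerDoorRecordThetaGS

end
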